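import Summits.BirchSwinnertonDyer.BirchSwinnertonDyer.Theorems.GenusKolyvaginAtTwoGenusPrimitiveSupplyAtTwoTwistMenuFrame
import Summits.BirchSwinnertonDyer.BirchSwinnertonDyer.Theorems.GenusKolyvaginAtTwoGenusPrimitiveSupplyAtTwoTwistSelmerTransferDownRat
import Summits.BirchSwinnertonDyer.BirchSwinnertonDyer.Theorems.GenusKolyvaginAtTwoK4NegTwinBsdRoadNonPhantomTwoAdicIff
import Summits.BirchSwinnertonDyer.BirchSwinnertonDyer.Theorems.GenusKolyvaginAtTwoK4NegPhantomFrameTraceBit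
import Literature.NumberTheory.EllipticCurves.KramerDescentLocalGeneratorsProofs
import HarnessLib

/-!
# Route `GenusKolyvaginAtTwo`, crux K₄⁻ `K4Neg` (stmt-BirchSwinnertonDyer-31526), the (β)/𝒫-frames of the phantom cell —
# PHANTOM PERSISTENCE UNDER DEEP TWISTING: the Lawson–Wuthrich class survives in `Sel₂` of EVERY quadratic twist by deep Kolyvagin primes

Seat `bsd-line-gk2-p3` g35 (PROVER seat 3/3, cell `bsd-f1-sign2`), `--supports stmt-BirchSwinnertonDyer-31526 --as helper`.
THEOREMS ONLY (no definition, no named fact, no `sorry`); standard axioms; UNCONDITIONAL.  **BSD is NOT proved by this file; `K4Neg` is NOT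
proved (nor refuted) by it; nothing is closed.**

WHY (LEAD-BRIEF-g29 §3, the (β)-verdict).  Modulo the route's own items K₄⁻'s private content is the family 𝒫 of prime Heegner frames
`K = ℚ(√−ℓ₀)` of a phantom-cell curve `E` (off the cut, `ξ_E ∈ Sel₂(E)`, `4 ∣ a_{ℓ₀}(E)`), where every mod-`2` Kolyvagin class `Γ_n` lies in
`{0, ξ_E}` and «no descent decides» whether some `Γ_n ≠ 0`.  This seat's reading (memo `K4NEG-BETA-GENUS-VERDICT-gk2p3-g35.md`, evidence on the
item) is the GENUS–GROSS–ZAGIER one: at a square-free product `n` of deep primes, `P(n) mod 2E(K[n])` is the Heegner `χ_n`-vector of the twist pair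
`(E^{(D_n)}, E^{(−ℓ₀ D_n)})`, `D_n = ∏(−ℓ_i)`, and BSD₂ of that pair + the explicit Gross–Zagier formula for `χ_n` force `P(n) ∈ 2E(K[n])` as soon as
the rank-`0` member of the pair has `Ш[2] ≠ 0`.  THIS FILE proves the unconditional Selmer-theoretic heart of that mechanism:
**the phantom `ξ_E` is a `2`-Selmer class of every such twist**, so the even-parity member always carries it in `Ш[2]`.

WHAT.
* §1 (any number field, any twist pair, X11b/`GenusKolyTwistLocal` currency) `mem_selmerGroup_transport_of_forall_agree_or_localization_eq_zero` —
  a Selmer class of `W` that localises to `0` at every place where a structure `𝓐` is not known to agree with `W`'s Kummer structure lies in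
  `H¹_𝓐`; ★ `two_le_natCard_selmerGroup_twist_of_menu_or_localization_eq_zero` — hence `#Sel₂(Wd) ≥ 2` for `Wd = C • W^{(d)}` as soon as `W`
  has a NON-ZERO `2`-Selmer class `c` such that every finite place is on the four-row Mazur–Rubin menu (split ∨ both-Tamagawa-odd ∨ both-good ∨
  both-silent) OR kills `c`, and every infinite place is on the two-row menu or kills `c` (Mazur–Rubin's `Sel_T ⊂ Sel(E^F)` with `T` = the
  places off the menu, for ONE class; inputs: the LEAD's / gk2-p4's / gk2-p5's transport menus and `natCard_selmerGroup_transport_kummer`).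
* §2 ★★ (the off-cut cell over `ℚ`) `localization_eq_zero_of_offCut_of_conductor_mem` (odd bad primes are STRICTLY silent) and
  `two_le_natCard_selmerGroup_twist_of_selmer_of_offCut` — `W/ℚ` globally minimal, `C(W)` odd, NO odd multiplicative prime, `Δ < 0`, `ξ ≠ 0` a
  `2`-SELMER class; `D ≠ 0`, `Wd` any elliptic model of `W^{(D)}`; at the place over `2`: `D` a `2`-adic square OR `loc₂ ξ = 0`; at every odd prime
  `ℓ ∣ D`: `ℓ ∤ N_W` and `loc_ℓ ξ = 0`.  THEN `#Sel₂(Wd) ≥ 2`.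
* §3 ★★★ (K4Neg's deep-prime currency) `exists_sq_eq_adicCompletion_two_of_eight_dvd` (`D ≡ 1 (8)` is a `2`-adic square),
  `two_le_natCard_selmerGroup_twist_of_phantom_selmer_of_deep` — §2 with «`loc_ℓ ξ = 0`» DISCHARGED for the Lawson–Wuthrich class `ξ` (`ρ̄_{W,2}`,
  `ρ_{W,4}` onto, `ξ` dying on `Γ_{ℚ(E[4])}`) at every odd `ℓ ∣ D` that is a prime of good reduction where some arithmetic Frobenius acts on `E[2]` as a
  complex conjugation and `4 ∣ a_ℓ(W)` (gk2-p4 g34's trace bit `mem_torsionLocalKer_padic_iff_four_dvd_frobeniusTrace`);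
  `deep_datum_of_frobEqFrobInfty_of_le_kolyvaginIndex` + ★★★ `two_le_natCard_selmerGroup_twist_of_phantom_selmer_of_kolyvaginPrimes` — the same
  with EXACTLY the clauses of K4Neg's conclusion (`FrobEqFrobInfty W K 2 ℓ`, `2 ≤ kolyvaginIndex W 2 ℓ`, any `K`).  READING: on the phantom cell NO
  product `D ≡ 1 (8)` of deep Kolyvagin primes (and no `D` at all when `loc₂ ξ_E = 0`, the `a₂ = 0` supersingular sub-cell) twists `E` to a
  `2`-Selmer-trivial curve; the even-parity member of every deep genus pair has `Ш[2] ∋ ξ_E ≠ 0` once its rank is `0`.  This is the input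
  «`Ш(E⁰_n)[2] ≠ 0`» of the memo's BSD-conditional verdict «`Γ_n = 0` on 𝒫-frames».

References: [MazurRubin2010] Def. 3.1, Lemma 2.10, Lemma 3.2, Prop. 3.3; [LawsonWuthrich2016] §3, §7.1; [GrossLMS1991] §3 (3.1)–(3.3), §9;
[MilneADT2006] I Cor. 2.3, Thm. 2.8, Rem. 3.7.
-/

set_option linter.dupNamespace false -- tree convention: `Summit.BirchSwinnertonDyer.BirchSwinnertonDyer.Theorems` (summit = sub-problem)
set_option autoImplicit false

noncomputable section

open scoped Classical NumberField ContRepresentation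

namespace Summit.BirchSwinnertonDyer.BirchSwinnertonDyer.Theorems.GenusExact.PhantomDescentBit.DeepTwist

open WeierstrassCurve Field NumberField IsDedekindDomain Function
open Literature.NumberTheory.EllipticCurves Literature.NumberTheory.GaloisRepresentations
open Literature.NumberTheory.GaloisRepresentations.DiscreteGaloisModule (SelmerStructure)
open Literature.NumberTheory.GaloisCohomology
open Summit.BirchSwinnertonDyer.Rank1Residual.X11b.CongruentTransfer
open Summit.BirchSwinnertonDyer.BirchSwinnertonDyer.Theorems.GenusKolyTwistLocal
open Summit.BirchSwinnertonDyer.BirchSwinnertonDyer.Theorems.GenusKolyTwistTamagawa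
  (transport_twist_agree_inr_of_menu transport_twist_agree_inl_of_menu)

/-! ## §1 A Selmer class killed at every non-menu place persists in the twist -/

section Generic

variable {K : Type} [Field K] [NumberField K] (W : WeierstrassCurve K) [W.IsElliptic]

omit [W.IsElliptic] in
/-- **A `n`-Selmer class of `W` localising to `0` wherever the structure `𝓐` is not known to agree with `W`'s Kummer structure lies in
`H¹_𝓐`** (both memberships are place-wise; `0 ∈ 𝓐_v`).  Mazur–Rubin's `Sel_T(E) ⊂ Sel(E^F)` for ONE class, with `T` = the places off
the agreement set. [cite: MazurRubin2010, Def. 3.1 and Lemma 3.2] -/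
theorem mem_selmerGroup_transport_of_forall_agree_or_localization_eq_zero (n : ℕ)
    (𝓐 : SelmerStructure (W.torsionGaloisModule (n : ℤ)))
    {c : galoisCohomology (W.torsionGaloisModule (n : ℤ)) 1}
    (hc : c ∈ (W.kummerSelmerStructure (n : ℤ)).selmerGroup)
    (h : ∀ v : Place K, 𝓐 v = W.kummerSelmerStructure (n : ℤ) v ∨
      galoisCohomology.localization (W.torsionGaloisModule (n : ℤ)) v 1 c = 0) :
    c ∈ 𝓐.selmerGroup := by
  rw [SelmerStructure.mem_selmerGroup_iff] at hc ⊢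
  intro v
  rcases h v with hv | hv
  · rw [hv]; exact hc v
  · rw [hv]; exact zero_mem _

variable (Wd : WeierstrassCurve K) [Wd.IsElliptic]

/-- ★ **`#Sel₂(Wd) ≥ 2` for a twist model `Wd = C • W^{(d)}` whenever `W` has a NON-ZERO `2`-Selmer class `c` such that every finite place
either kills `c` or lies on the four-row Mazur–Rubin menu (split in `K(√d)` ∨ odd with both local Tamagawa numbers odd ∨ odd and good for
both ∨ odd and silent for both), and every infinite place either kills `c` or lies on the two-row menu (split ∨ `H¹ = 0` for both).**
Proof: transport `𝓚_{Wd}` along the canonical identification `Wd[2] ≅ W[2]` (`exists_intertwining_hsplit_and_transverse_frame`); the menus give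
agreement with `𝓚_W` at the menu places (`transport_twist_agree_inr/inl_of_menu`), §1 puts `c` in the transported Selmer group, whose order is
`#Sel₂(Wd)` (`natCard_selmerGroup_transport_kummer`); `0 ≠ c` are two of its elements.
[cite: MazurRubin2010, Lemma 2.10, Def. 3.1, Lemma 3.2] [cite: MilneADT2006, I Rem. 3.7] -/
theorem two_le_natCard_selmerGroup_twist_of_menu_or_localization_eq_zero {d : K} (hd : d ≠ 0) {C : VariableChange K}
    (hWd : C • W.quadraticTwist d = Wd)
    {c : galoisCohomology (W.torsionGaloisModule ((2 : ℕ) : ℤ)) 1}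
    (hc : c ∈ (W.kummerSelmerStructure ((2 : ℕ) : ℤ)).selmerGroup) (hc0 : c ≠ 0)
    (hfin : ∀ v : HeightOneSpectrum (𝓞 K),
      galoisCohomology.localization (W.torsionGaloisModule ((2 : ℕ) : ℤ)) (Sum.inr v) 1 c = 0 ∨
      ((∃ s : v.adicCompletion K, s ^ 2 = algebraMap K (v.adicCompletion K) d) ∨
      (((2 : ℕ) : 𝓞 K) ∉ v.asIdeal ∧
        ¬ 2 ∣ (W.baseChange (v.adicCompletion K)).localTamagawaNumber (v.adicCompletionIntegers K) ∧
        ¬ 2 ∣ (Wd.baseChange (v.adicCompletion K)).localTamagawaNumber (v.adicCompletionIntegers K)) ∨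
      (((2 : ℕ) : 𝓞 K) ∉ v.asIdeal ∧ W.HasGoodReductionAt v ∧ Wd.HasGoodReductionAt v) ∨
      (((2 : ℕ) : 𝓞 K) ∉ v.asIdeal ∧
        Nat.card (nsmulAddMonoidHom 2 : (W.baseChange (v.adicCompletion K)).toAffine.Point →+ _).ker = 1 ∧
        Nat.card (nsmulAddMonoidHom 2 : (Wd.baseChange (v.adicCompletion K)).toAffine.Point →+ _).ker = 1)))
    (hinf : ∀ w : InfinitePlace K,
      galoisCohomology.localization (W.torsionGaloisModule ((2 : ℕ) : ℤ)) (Sum.inl w) 1 c = 0 ∨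
      ((∃ s : w.Completion, s ^ 2 = algebraMap K w.Completion d) ∨
      ((∀ x : galoisCohomology (W.localGaloisModule w.Completion) 1, x = 0) ∧
        (∀ x : galoisCohomology (Wd.localGaloisModule w.Completion) 1, x = 0)))) :
    2 ≤ Nat.card (Wd.selmerGroup ((2 : ℕ) : ℤ)) := by
  haveI : Fact (Nat.Prime 2) := ⟨Nat.prime_two⟩
  obtain ⟨φ, ψ, hψφ, hφψ, hsplit, -, -⟩ := exists_intertwining_hsplit_and_transverse_frame W Wd hd hWd
  let 𝓐 : SelmerStructure (W.torsionGaloisModule ((2 : ℕ) : ℤ)) := fun v ↦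
    (Wd.kummerSelmerStructure ((2 : ℕ) : ℤ) v).map (galoisCohomology.map (φ.restrictField (Place.Completion v)) 1)
  have h𝓐 : ∀ v, 𝓐 v = (Wd.kummerSelmerStructure ((2 : ℕ) : ℤ) v).map
      (galoisCohomology.map (φ.restrictField (Place.Completion v)) 1) := fun _ ↦ rfl
  have hmem : c ∈ 𝓐.selmerGroup := by
    refine mem_selmerGroup_transport_of_forall_agree_or_localization_eq_zero W 2 𝓐 hc ?_
    rintro (w | v)
    · rcases hinf w with h0 | hm
      · exact Or.inr h0
      · exact Or.inl (transport_twist_agree_inl_of_menu W φ ψ hφψ hsplit 𝓐 h𝓐 w hm)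
    · rcases hfin v with h0 | hm
      · exact Or.inr h0
      · exact Or.inl (transport_twist_agree_inr_of_menu W φ ψ hφψ hsplit 𝓐 h𝓐 v hm)
  have hcard : Nat.card 𝓐.selmerGroup = Nat.card (Wd.selmerGroup ((2 : ℕ) : ℤ)) :=
    natCard_selmerGroup_transport_kummer W Wd 2 φ ψ hψφ hφψ 𝓐 h𝓐
  haveI : Finite (Wd.selmerGroup ((2 : ℕ) : ℤ)) := Wd.finite_selmerGroup_holds (by norm_num)
  have hpos : 0 < Nat.card (Wd.selmerGroup ((2 : ℕ) : ℤ)) := Nat.card_pos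
  haveI : Finite 𝓐.selmerGroup := Nat.finite_of_card_ne_zero (by rw [hcard]; exact hpos.ne')
  haveI : Nontrivial 𝓐.selmerGroup :=
    ⟨⟨⟨c, hmem⟩, ⟨0, zero_mem _⟩, fun h ↦ hc0 (Subtype.ext_iff.mp h)⟩⟩
  rw [← hcard]
  exact Finite.one_lt_card

end Generic

/-! ## §2 ★★ The phantom cell over `ℚ`: `ξ_E ∈ Sel₂` of every twist by primes that kill it -/

section OffCut

open Rat.HeightOneSpectrum (primesEquiv)

variable (W : WeierstrassCurve ℚ) [W.IsElliptic] [W.IsGloballyMinimal] [NeZero (W.conductorNorm ℤ)]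

/-- **Off the cut, odd bad primes are STRICTLY silent**: `W/ℚ` globally minimal with `C(W)` odd and no odd multiplicative prime, `v` a finite
place with `2 ∉ v`, `N_W ∈ v`; then every class of `H¹(ℚ, E[2])` localises to `0` at `v` (the prime under `v` is odd additive with odd Tamagawa
number, so `H¹(ℚ_v, E[2]) = 0`: gk2-p5 g20 `NonPhantom.mem_selmerLocalKer_and_mem_torsionLocalKer_of_additive_of_odd_tamagawaProduct`).
[cite: MilneADT2006, Ch. I, Cor. 2.3 and Thm. 2.8] [cite: SilvermanAEC2009, VII.2 Prop. 2.1, VII.3 Prop. 3.1] -/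
theorem localization_eq_zero_of_offCut_of_conductor_mem (hT : Odd W.tamagawaProduct)
    (hoff : ¬ ∃ v : HeightOneSpectrum (𝓞 ℚ), ((2 : ℕ) : 𝓞 ℚ) ∉ v.asIdeal ∧ ((W.conductorNorm ℤ : ℕ) : 𝓞 ℚ) ∈ v.asIdeal ∧
      W.HasMultiplicativeReductionAt v)
    (v : HeightOneSpectrum (𝓞 ℚ)) (h2v : ((2 : ℕ) : 𝓞 ℚ) ∉ v.asIdeal) (hNv : ((W.conductorNorm ℤ : ℕ) : 𝓞 ℚ) ∈ v.asIdeal)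
    (x : galH1Torsion W ((2 : ℕ) : ℤ)) :
    galoisCohomology.localization (W.torsionGaloisModule ((2 : ℕ) : ℤ)) (Sum.inr v) 1 x = 0 := by
  have hN0 : W.conductorNorm ℤ ≠ 0 := NeZero.ne _
  obtain ⟨ℓ, hℓp, hℓN, hℓv⟩ := v.asIdeal.exists_prime_dvd_and_natCast_mem hN0 hNv
  have hvℓ : ((primesEquiv v : Nat.Primes) : ℕ) = ℓ := GenusKolyTwistingPrime.primesEquiv_eq hℓp hℓv
  subst hvℓ
  haveI : Fact ((primesEquiv v : Nat.Primes) : ℕ).Prime := ⟨hℓp⟩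
  have hℓ2 : ((primesEquiv v : Nat.Primes) : ℕ) ≠ 2 := by
    intro h
    rw [h] at hℓv
    exact h2v hℓv
  have hng : ¬ W.HasGoodReductionAtPrime ((primesEquiv v : Nat.Primes) : ℕ) :=
    (W.dvd_conductorNorm_iff_not_hasGoodReductionAtPrime _).mp hℓN
  have hnm : ¬ W.HasMultiplicativeReductionAtPrime ((primesEquiv v : Nat.Primes) : ℕ) := fun hm ↦
    hoff ⟨v, h2v, hNv, (W.hasMultiplicativeReductionAtPrime_iff_hasMultiplicativeReductionAt_ringOfIntegers v).mp hm⟩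
  have h := (NonPhantom.mem_selmerLocalKer_and_mem_torsionLocalKer_of_additive_of_odd_tamagawaProduct W _ hℓ2 hng hnm hT
    v hℓv 1 x).2
  exact (mem_torsionLocalKer_iff_localization_eq_zero_rat W v x).mp h

/-- ★★ **PHANTOM PERSISTENCE ON THE PHANTOM CELL.**  `E = W/ℚ` globally minimal elliptic, `C(W)` odd, NO odd multiplicative prime (off the cut),
`Δ < 0`; `ξ ≠ 0` a `2`-SELMER class of `W` (on the phantom cell: the Lawson–Wuthrich class); `D ≠ 0` an integer and `Wd` any elliptic model of the
twist `W^{(D)}`.  Suppose: at the place over `2`, `D` is a `2`-adic square OR `loc₂ ξ = 0`; at every ODD prime `ℓ ∣ D`, `ℓ ∤ N_W` and `loc_ℓ ξ = 0`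
(`ξ ∈ W.torsionLocalKer ℚ_ℓ 2`).  THEN `#Sel₂(Wd) ≥ 2` — indeed `ξ`, read on `Wd[2] = W[2]`, is a non-zero `2`-Selmer class of `Wd`: odd bad primes
are strictly silent (previous lemma), odd good primes `∤ D` are good for both models, `H¹(ℝ, ·) = 0` on `Δ < 0`, and the remaining places kill `ξ`.
So NO twist by «primes invisible to `ξ`» is `2`-Selmer-trivial; when such a twist has rank `0` its `Ш[2] ∋ ξ` is non-zero.  BSD is NOT proved by this.
[cite: MazurRubin2010, Lemma 2.10, Def. 3.1, Lemma 3.2] [cite: LawsonWuthrich2016, §7.1] [cite: MilneADT2006, I Cor. 2.3, Thm. 2.8, Rem. 3.7] -/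
theorem two_le_natCard_selmerGroup_twist_of_selmer_of_offCut (hT : Odd W.tamagawaProduct)
    (hoff : ¬ ∃ v : HeightOneSpectrum (𝓞 ℚ), ((2 : ℕ) : 𝓞 ℚ) ∉ v.asIdeal ∧ ((W.conductorNorm ℤ : ℕ) : 𝓞 ℚ) ∈ v.asIdeal ∧
      W.HasMultiplicativeReductionAt v)
    (hΔ : W.Δ < 0) {ξ : galH1Torsion W ((2 : ℕ) : ℤ)} (hξ0 : ξ ≠ 0) (hξS : ξ ∈ W.selmerGroup ((2 : ℕ) : ℤ))
    {D : ℤ} (hD : D ≠ 0) (Wd : WeierstrassCurve ℚ) [Wd.IsElliptic] {C : VariableChange ℚ}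
    (hWd : C • W.quadraticTwist (D : ℚ) = Wd)
    (h2 : ∀ v : HeightOneSpectrum (𝓞 ℚ), ((2 : ℕ) : 𝓞 ℚ) ∈ v.asIdeal →
      (∃ s : v.adicCompletion ℚ, s ^ 2 = algebraMap ℚ (v.adicCompletion ℚ) (D : ℚ)) ∨
        ξ ∈ W.torsionLocalKer (v.adicCompletion ℚ) ((2 : ℕ) : ℤ))
    (hD' : ∀ (ℓ : ℕ) [Fact ℓ.Prime], ℓ ≠ 2 → (ℓ : ℤ) ∣ D →
      ¬ ℓ ∣ W.conductorNorm ℤ ∧ ξ ∈ W.torsionLocalKer ℚ_[ℓ] ((2 : ℕ) : ℤ)) :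
    2 ≤ Nat.card (Wd.selmerGroup ((2 : ℕ) : ℤ)) := by
  have hD0 : (D : ℚ) ≠ 0 := by exact_mod_cast hD
  have hc : ξ ∈ (W.kummerSelmerStructure ((2 : ℕ) : ℤ)).selmerGroup := by
    rw [← selmerGroup_eq_selmerGroup_kummerSelmerStructure]; exact hξS
  refine two_le_natCard_selmerGroup_twist_of_menu_or_localization_eq_zero W Wd hD0 hWd hc hξ0 (fun v ↦ ?_)
    (fun w ↦ Or.inr (twist_place_menu_infinite_rat W hΔ hD0 hWd w))
  letI : Algebra ℚ (v.adicCompletion ℚ) := inferInstance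
  haveI : CharZero (v.adicCompletion ℚ) :=
    Literature.NumberTheory.GaloisRepresentations.charZero_adicCompletion v
  by_cases h2v : ((2 : ℕ) : 𝓞 ℚ) ∈ v.asIdeal
  · -- the place over `2`: split or killed
    rcases h2 v h2v with hs | h0
    · exact Or.inr (Or.inl hs)
    · exact Or.inl ((mem_torsionLocalKer_iff_localization_eq_zero_rat W v ξ).mp h0)
  by_cases hNv : ((W.conductorNorm ℤ : ℕ) : 𝓞 ℚ) ∈ v.asIdeal
  · -- odd bad prime: strictly silent off the cut
    exact Or.inl (localization_eq_zero_of_offCut_of_conductor_mem W hT hoff v h2v hNv ξ)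
  -- odd prime `p ∤ N_W`: good for `W`
  haveI := Fact.mk (primesEquiv v).2
  set p : ℕ := ((primesEquiv v : Nat.Primes) : ℕ) with hp
  have hpP : p.Prime := (primesEquiv v).2
  have hpv : (p : 𝓞 ℚ) ∈ v.asIdeal := Rat.HeightOneSpectrum.natCast_natGenerator_mem v
  have hp2 : p ≠ 2 := by
    intro h
    rw [h] at hpv
    exact h2v hpv
  have hpN : ¬ p ∣ W.conductorNorm ℤ := by
    rintro ⟨k, hk⟩
    apply hNv
    have : ((W.conductorNorm ℤ : ℕ) : 𝓞 ℚ) = (p : 𝓞 ℚ) * (k : 𝓞 ℚ) := by rw [hk, Nat.cast_mul]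
    rw [this]
    exact v.asIdeal.mul_mem_right _ hpv
  have hW : W.HasGoodReductionAt v := by
    by_contra h
    exact hpN ((W.dvd_conductorNorm_iff v).mpr h)
  by_cases hpD : (p : ℤ) ∣ D
  · -- `p ∣ D`: `ξ` is killed at `p`
    obtain ⟨-, hξp⟩ := hD' p hp2 hpD
    have h1 : ξ ∈ W.torsionLocalKer (v.adicCompletion ℚ) ((2 : ℕ) : ℤ) :=
      (GenusKolyTwistingPrime.mem_torsionLocalKer_padic_iff W
        (RingEquivClass.toRingEquiv (Rat.HeightOneSpectrum.adicCompletion.padicEquiv (R := 𝓞 ℚ) v))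
        ((2 : ℕ) : ℤ) ξ).mp hξp
    exact Or.inl ((mem_torsionLocalKer_iff_localization_eq_zero_rat W v ξ).mp h1)
  · -- `p ∤ 2 D N_W`: good for both
    have hpd : ¬ ((p : ℕ) : ℤ) ∣ 2 * D := by
      intro h
      rcases (Nat.prime_iff_prime_int.mp hpP).dvd_or_dvd h with h2' | hD''
      · exact hp2 ((Nat.prime_dvd_prime_iff_eq hpP Nat.prime_two).mp (by exact_mod_cast h2'))
      · exact hpD hD''
    exact Or.inr (Or.inr (Or.inr (Or.inl ⟨h2v, hW, hasGoodReductionAt_of_smul_quadraticTwist W v hpd hW hWd⟩)))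

end OffCut

/-! ## §3 ★★★ K4Neg's currency: deep Kolyvagin primes (`Frob_ℓ = Frob_∞` on `E[2]`, `4 ∣ a_ℓ`) kill the phantom -/

section Deep

open Rat.HeightOneSpectrum (primesEquiv)

variable (W : WeierstrassCurve ℚ) [W.IsElliptic] [W.IsGloballyMinimal] [NeZero (W.conductorNorm ℤ)]

/-- **An integer `≡ 1 (mod 8)` is a square in the completion of `ℚ` at the place over `2`** (Serre II.3.3 Thm 4, tree
`KramerLocal.padicTwo_isSquare_intCast`, transported along `padicEquiv`). [cite: Serre1973, Ch. II §3.3 Thm 4] -/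
theorem exists_sq_eq_adicCompletion_two_of_eight_dvd {D : ℤ} (h8 : (8 : ℤ) ∣ D - 1)
    (v : HeightOneSpectrum (𝓞 ℚ)) (h2v : ((2 : ℕ) : 𝓞 ℚ) ∈ v.asIdeal) :
    ∃ s : v.adicCompletion ℚ, s ^ 2 = algebraMap ℚ (v.adicCompletion ℚ) (D : ℚ) := by
  haveI := WeierstrassCurve.fact_prime_primesEquiv v
  have hv2 : ((primesEquiv v : Nat.Primes) : ℕ) = 2 := GenusKolyTwistingPrime.primesEquiv_eq Nat.prime_two h2v
  have key : ∀ q : Nat.Primes, (q : ℕ) = 2 →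
      haveI := Fact.mk q.2; IsSquare (((D : ℚ) : ℚ) : ℚ_[(q : ℕ)]) := by
    rintro ⟨q, hq⟩ hq2
    change q = 2 at hq2
    subst hq2
    have h := KramerLocal.padicTwo_isSquare_intCast h8
    simpa using h
  have hsq : IsSquare (((D : ℚ) : ℚ) : ℚ_[((primesEquiv v : Nat.Primes) : ℕ)]) := key _ hv2
  obtain ⟨s, hs⟩ := TwoDescentLocal.isSquare_algebraMap_adicCompletion_of_padic v hsq
  exact ⟨s, by rw [sq]; exact hs.symm⟩

/-- ★★★ **PHANTOM PERSISTENCE UNDER DEEP TWISTING, in the currency of K4Neg's conclusion.**  `E = W/ℚ` globally minimal, `C(W)` odd, NO odd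
multiplicative prime, `Δ < 0`, `ρ̄_{W,2}` and `ρ_{W,4}` onto; `ξ ≠ 0` in `H¹(ℚ, E[2])` dying on `Γ_{ℚ(E[4])}` (the Lawson–Wuthrich class) and
SELMER (the phantom cell).  Let `D ≠ 0` be an integer whose odd prime factors `ℓ` are all «deep Kolyvagin primes of `E` at `2`» in the exact sense
of K4Neg's conclusion, read over `ℚ`: `ℓ ∤ N_W`, some arithmetic Frobenius at `ℓ` acts on `E[2]` as a complex conjugation (Gross's (3.2) at level
`2`, `FrobEqFrobInfty W K 2 ℓ`), and `4 ∣ a_ℓ(W)` (`2 ≤ kolyvaginIndex W 2 ℓ`).  At the place over `2` suppose `D ≡ 1 (mod 8)` or `loc₂ ξ = 0`.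
THEN every elliptic model `Wd` of `W^{(D)}` has `#Sel₂(Wd) ≥ 2`.  (gk2-p4 g34's trace bit: at such `ℓ`, `loc_ℓ ξ = 0 ⟺ 4 ∣ a_ℓ`; then §2.)
READING for the (β)/𝒫 census of LEAD-BRIEF-g29 §3: the rank-`0` member of every deep genus pair `(E^{(D_n)}, E^{(−ℓ₀ D_n)})` carries
`ξ_E` in `Ш[2]` — the input of the genus–Gross–Zagier verdict (memo).  BSD is NOT proved by this; K4Neg is neither proved nor refuted here.
[cite: GrossLMS1991, §3 (3.1)–(3.3)] [cite: MazurRubin2010, Lemma 2.10, Def. 3.1, Lemma 3.2] [cite: LawsonWuthrich2016, §3, §7.1]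
[cite: Serre1973, Ch. II §3.3 Thm 4] -/
theorem two_le_natCard_selmerGroup_twist_of_phantom_selmer_of_deep (hT : Odd W.tamagawaProduct)
    (hoff : ¬ ∃ v : HeightOneSpectrum (𝓞 ℚ), ((2 : ℕ) : 𝓞 ℚ) ∉ v.asIdeal ∧ ((W.conductorNorm ℤ : ℕ) : 𝓞 ℚ) ∈ v.asIdeal ∧
      W.HasMultiplicativeReductionAt v)
    (hΔ : W.Δ < 0) (hsurj : W.HasSurjectiveModNGaloisRep 2) (hsurj4 : W.HasSurjectiveModNGaloisRep 4)
    {ξ : galH1Torsion W (2 : ℤ)} (hξ0 : ξ ≠ 0) (hξ4 : ∀ h ∈ torsionFixing W (4 : ℤ), h1Eval W (2 : ℤ) ξ h = 0)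
    (hξS : ξ ∈ W.selmerGroup 2)
    {D : ℤ} (hD : D ≠ 0) (Wd : WeierstrassCurve ℚ) [Wd.IsElliptic] {C : VariableChange ℚ}
    (hWd : C • W.quadraticTwist (D : ℚ) = Wd)
    (h2 : (8 : ℤ) ∣ D - 1 ∨ ∀ v : HeightOneSpectrum (𝓞 ℚ), ((2 : ℕ) : 𝓞 ℚ) ∈ v.asIdeal →
      ξ ∈ W.torsionLocalKer (v.adicCompletion ℚ) (2 : ℤ))
    (hdeep : ∀ (ℓ : ℕ), ℓ.Prime → ℓ ≠ 2 → (ℓ : ℤ) ∣ D →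
      ¬ ℓ ∣ W.conductorNorm ℤ ∧ (4 : ℤ) ∣ W.frobeniusTrace ℓ ∧
      ∃ (v : HeightOneSpectrum (𝓞 ℚ)) (𝔓 : Ideal (absIntegers (𝓞 ℚ) ℚ)) (γ c₀ : absoluteGaloisGroup ℚ),
        (ℓ : 𝓞 ℚ) ∈ v.asIdeal ∧ 𝔓 ∈ v.primesAbove ∧ IsArithFrobAt (𝓞 ℚ) γ 𝔓 ∧
        IsComplexConjugation (Rat.castHom ℝ) c₀ ∧ ∀ T : geomTorsion W (2 : ℤ), γ • T = c₀ • T) :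
    2 ≤ Nat.card (Wd.selmerGroup 2) := by
  refine two_le_natCard_selmerGroup_twist_of_selmer_of_offCut W hT hoff hΔ (ξ := ξ) hξ0 hξS hD Wd hWd ?_ ?_
  · -- the place over `2`
    intro v h2v
    rcases h2 with h8 | hloc
    · exact Or.inl (exists_sq_eq_adicCompletion_two_of_eight_dvd h8 v h2v)
    · exact Or.inr (hloc v h2v)
  · -- odd primes dividing `D`: deep ⟹ `loc_ℓ ξ = 0` (the trace bit)
    intro ℓ _ hℓ2 hℓD
    have hℓ : ℓ.Prime := Fact.out
    obtain ⟨hℓN, h4, v, 𝔓, γ, c₀, hℓv, h𝔓, hγ, hc₀, hγc⟩ := hdeep ℓ hℓ hℓ2 hℓD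
    refine ⟨hℓN, ?_⟩
    have hW : W.HasGoodReductionAt v := by
      by_contra h
      exact hℓN ((GenusKolyTwistingPrime.primesEquiv_eq hℓ hℓv) ▸ (W.dvd_conductorNorm_iff v).mpr h)
    have hsq : c₀ * c₀ = 1 := by have h := hc₀.sq_eq_one; rwa [sq] at h
    have hinv : ∀ T : geomTorsion W (2 : ℤ), γ • γ • T = T := fun T ↦ by
      rw [hγc, hγc, ← mul_smul, hsq, one_smul]
    have hγT : ∃ T : geomTorsion W (2 : ℤ), γ • T ≠ T := by
      obtain ⟨T, hT'⟩ := KolyvaginEigenTwo.exists_twoTorsion_smul_ne_of_Δ_neg W hΔ hc₀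
      exact ⟨T, fun h ↦ hT' (by rw [← hγc, h])⟩
    exact (TraceBit.mem_torsionLocalKer_padic_iff_four_dvd_frobeniusTrace W hsurj hsurj4 hξ0 hξ4 hℓ2 hℓv hW h𝔓 hγ
      hinv hγT).mpr h4

omit [W.IsElliptic] [NeZero (W.conductorNorm ℤ)] in
/-- **The deep-prime datum from K4Neg's literal clauses.**  For any number field `K`: `FrobEqFrobInfty W K 2 ℓ` (Gross's (3.2) at level `2`)
supplies an arithmetic Frobenius at `ℓ` acting on `E[2]` as a complex conjugation, and `2 ≤ kolyvaginIndex W 2 ℓ` gives `4 ∣ a_ℓ(W)`.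
[cite: GrossLMS1991, §3 (3.2)–(3.3)] [cite: WZhang2014, Notations (xii)] -/
theorem deep_datum_of_frobEqFrobInfty_of_le_kolyvaginIndex {K : Type} [Field K] [NumberField K] {ℓ : ℕ}
    (hF : FrobEqFrobInfty W K 2 ℓ) (hk : 2 ≤ Zhang2014.kolyvaginIndex W 2 ℓ) :
    (4 : ℤ) ∣ W.frobeniusTrace ℓ ∧
      ∃ (v : HeightOneSpectrum (𝓞 ℚ)) (𝔓 : Ideal (absIntegers (𝓞 ℚ) ℚ)) (γ c₀ : absoluteGaloisGroup ℚ),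
        (ℓ : 𝓞 ℚ) ∈ v.asIdeal ∧ 𝔓 ∈ v.primesAbove ∧ IsArithFrobAt (𝓞 ℚ) γ 𝔓 ∧
        IsComplexConjugation (Rat.castHom ℝ) c₀ ∧ ∀ T : geomTorsion W (2 : ℤ), γ • T = c₀ • T := by
  haveI : Fact (Nat.Prime 2) := ⟨Nat.prime_two⟩
  obtain ⟨-, h4⟩ := (Zhang2014.le_kolyvaginIndex_iff (W := W) (p := 2)).mp hk
  obtain ⟨v, 𝔓, γ, c₀, hℓv, h𝔓, hγ, hc₀, hP, -⟩ := hF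
  refine ⟨by norm_num at h4; exact h4, v, 𝔓, γ, c₀, hℓv, h𝔓, hγ, hc₀, fun T ↦ hP T⟩

/-- ★★★ **K4Neg-LITERAL FORM.**  On the phantom cell (`W/ℚ` globally minimal, `C(W)` odd, off the cut, `Δ < 0`, `ρ̄_{W,2}`, `ρ_{W,4}` onto, the
Lawson–Wuthrich class `ξ` Selmer), for ANY number field `K` and ANY integer `D ≠ 0` with `D ≡ 1 (mod 8)` (or `loc₂ ξ = 0`) all of whose odd
prime factors `ℓ` satisfy K4Neg's deep-prime clauses `ℓ ∤ N_W`, `FrobEqFrobInfty W K 2 ℓ`, `2 ≤ kolyvaginIndex W 2 ℓ`: every elliptic model of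
`W^{(D)}` has `#Sel₂ ≥ 2`.  In particular with `D = D_n = ∏_{ℓ ∣ n}(−ℓ)` for a square-free `n` as in K4Neg's conclusion (all `ℓ ≡ 3 (4)`, so
`D_n ≡ 1 (8)` iff an even number of the `ℓ` are `≡ 3 (8)`): the even-parity member of the genus pair at level `n` is never `2`-Selmer-trivial.
BSD is NOT proved by this; K4Neg is neither proved nor refuted here. [cite: GrossLMS1991, §3 (3.1)–(3.3)] [cite: MazurRubin2010, Lemma 2.10, Lemma 3.2]
[cite: LawsonWuthrich2016, §3, §7.1] [cite: WZhang2014, Notations (xii)] -/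
theorem two_le_natCard_selmerGroup_twist_of_phantom_selmer_of_kolyvaginPrimes {K : Type} [Field K] [NumberField K]
    (hT : Odd W.tamagawaProduct)
    (hoff : ¬ ∃ v : HeightOneSpectrum (𝓞 ℚ), ((2 : ℕ) : 𝓞 ℚ) ∉ v.asIdeal ∧ ((W.conductorNorm ℤ : ℕ) : 𝓞 ℚ) ∈ v.asIdeal ∧
      W.HasMultiplicativeReductionAt v)
    (hΔ : W.Δ < 0) (hsurj : W.HasSurjectiveModNGaloisRep 2) (hsurj4 : W.HasSurjectiveModNGaloisRep 4)
    {ξ : galH1Torsion W (2 : ℤ)} (hξ0 : ξ ≠ 0) (hξ4 : ∀ h ∈ torsionFixing W (4 : ℤ), h1Eval W (2 : ℤ) ξ h = 0)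
    (hξS : ξ ∈ W.selmerGroup 2)
    {D : ℤ} (hD : D ≠ 0) (Wd : WeierstrassCurve ℚ) [Wd.IsElliptic] {C : VariableChange ℚ}
    (hWd : C • W.quadraticTwist (D : ℚ) = Wd)
    (h2 : (8 : ℤ) ∣ D - 1 ∨ ∀ v : HeightOneSpectrum (𝓞 ℚ), ((2 : ℕ) : 𝓞 ℚ) ∈ v.asIdeal →
      ξ ∈ W.torsionLocalKer (v.adicCompletion ℚ) (2 : ℤ))
    (hdeep : ∀ (ℓ : ℕ), ℓ.Prime → ℓ ≠ 2 → (ℓ : ℤ) ∣ D →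
      ¬ ℓ ∣ W.conductorNorm ℤ ∧ FrobEqFrobInfty W K 2 ℓ ∧ 2 ≤ Zhang2014.kolyvaginIndex W 2 ℓ) :
    2 ≤ Nat.card (Wd.selmerGroup 2) := by
  refine two_le_natCard_selmerGroup_twist_of_phantom_selmer_of_deep W hT hoff hΔ hsurj hsurj4 hξ0 hξ4 hξS hD Wd hWd h2 ?_
  intro ℓ hℓ hℓ2 hℓD
  obtain ⟨hℓN, hF, hk⟩ := hdeep ℓ hℓ hℓ2 hℓD
  exact ⟨hℓN, deep_datum_of_frobEqFrobInfty_of_le_kolyvaginIndex W hF hk⟩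

end Deep

end Summit.BirchSwinnertonDyer.BirchSwinnertonDyer.Theorems.GenusExact.PhantomDescentBit.DeepTwist

end
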